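import Summits.CriticalPhenomena.PercolationContinuityZ3.Theses.PercFiniteBoxLRO
import Literature.Probability.Percolation.SlabCriticalityInputs
import Literature.Probability.Percolation.ConnectivityProofs
import Literature.Probability.Percolation.HalfSpaceBGN

/-!
# Crux `PercFiniteBoxLRO.RenormaliseFromLinearLRO` (stmt-CriticalPhenomena-0857), line `registered` —
# the objects of the same-`p` static renormalisation (good boxes and the planar coarse-graining)

Definitions (and their elementary measurability / locality properties) shared by the helper files of the
line `registered` of crux stmt-CriticalPhenomena-0857; lands `--supports stmt-CriticalPhenomena-0857`.
All later files of the line are definition-free. It also proves the registered stub `stub_goodBoxLocal`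
(locality of `G_n`).

* `goodBox n` — Grimmett's good-box event `G_n` of `B(n) = box 3 n ⊆ ℤ³` (Percolation, 2nd ed. 1999,
  §7.4 p.177, clauses (a) crossing cluster + (b) in-box uniqueness of the clusters of coordinate spread
  `≥ n`; no density clause): VERBATIM the set appearing in the registered stubs of the crux and in the
  sibling items stmt-3826 / 3840 / 3841 of route `PercOpenSupercrit`;
* `blockCentre n a = n·(a₀, a₁, 0)`, `goodBlock n a` (the translate of `G_n` to `blockCentre n a + B(n)`),
  `coarseCfg n ω` (the coarse good-edge configuration on `ℤ²`: `{a, a + eᵢ}` open iff both blocks are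
  good) and `coarseLaw n p = (coarseCfg n)_* P_p` — the planar layer of blocks of Grimmett (7.57)–(7.58)
  in the shape consumed by the PROVED dependent-percolation theorem
  `Literature.Probability.Percolation.DuminilCopinSidoraviciusTassion2016_dependentPercolation_holds`;
* plumbing: `isLocalEvent_goodBox` (witness `(box 3 n).sym2`), `measurableSet_goodBox`,
  `measurableSet_goodBlock`, `measurable_coarseCfg`, `isProbabilityMeasure_coarseLaw`,
  `continuous_real_goodBox` (`q ↦ P_q(G_n)` is continuous, Grimmett §7.3 p.162).

Sources: G. Grimmett, *Percolation*, 2nd ed. (1999), §7.4 pp.177–181; H. Duminil-Copin,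
V. Sidoravicius, V. Tassion, Comm. Pure Appl. Math. 69 (2016) §2.2 (coarse graining). The objects are
those of the registered skeleton `Cruxes/GoodBoxCriterionSameP/Lines/birth.lean` (planner-skel-3840),
re-homed here so that Theorems files can import them.
-/

noncomputable section

namespace Summit.CriticalPhenomena.PercolationContinuityZ3.Theorems.RenormaliseFromLinearLRO

open Literature.Probability.Percolation Literature.Probability.LatticeModels
open MeasureTheory

/-! ## The good-box event -/

/-- Grimmett's good-box event `G_n` of `B(n) = box 3 n`: (a) some vertex `x` is joined inside `B(n)` to
both faces `u_i = -n`, `v_i = n` for every direction `i` (a crossing cluster); (b) any two vertices whose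
clusters inside `B(n)` have coordinate spread `≥ n` are joined inside `B(n)` (in-box uniqueness).
Grimmett, Percolation (1999), §7.4 p.177 (a)+(b). Verbatim the event of the crux's registered stubs. -/
def goodBox (n : ℕ) : Set (BondConfig (Site 3)) :=
  {ω : BondConfig (Site 3) |
    (∃ x : Site 3, ∀ i : Fin 3,
        (∃ u : Site 3, u i = -(n : ℤ) ∧ ω ∈ openConnIn ↑(box 3 n) x u) ∧
        (∃ v : Site 3, v i = (n : ℤ) ∧ ω ∈ openConnIn ↑(box 3 n) x v)) ∧
    (∀ x y : Site 3,
      (∃ u v : Site 3, ω ∈ openConnIn ↑(box 3 n) x u ∧ ω ∈ openConnIn ↑(box 3 n) x v ∧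
          ∃ i, (n : ℤ) ≤ |u i - v i|) →
      (∃ u v : Site 3, ω ∈ openConnIn ↑(box 3 n) y u ∧ ω ∈ openConnIn ↑(box 3 n) y v ∧
          ∃ i, (n : ℤ) ≤ |u i - v i|) →
      ω ∈ openConnIn ↑(box 3 n) x y)}

/-! ## The planar layer of blocks and its coarse configuration -/

/-- The centre `n·(a₀, a₁, 0) ∈ ℤ³` of the block `a ∈ ℤ²` of the planar layer of blocks (spacing `n`,
neighbouring boxes overlap in a slab of width `n`; Grimmett 1999 (7.57) `B_x = nx + B(n)`). -/
def blockCentre (n : ℕ) (a : Site 2) : Site 3 := ![(n : ℤ) * a 0, (n : ℤ) * a 1, 0]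

/-- The good-block event of the block `a`: the translate of `G_n` to the box `blockCentre n a + B(n)`,
i.e. `ω` is good at `a` iff the configuration shifted back by the centre,
`relabel (shift (-c)) ω` (`s(x, y) ∈ · ↔ s(x + c, y + c) ∈ ω`), lies in `goodBox n`
(Grimmett 1999, §7.4 (7.58)). -/
def goodBlock (n : ℕ) (a : Site 2) : Set (BondConfig (Site 3)) :=
  (BondConfig.relabel (sym2Equiv (Site.shift (-blockCentre n a)))) ⁻¹' goodBox n

/-- The coarse good-edge configuration on `ℤ²`: the nearest-neighbour edge `{a, a + eᵢ}` is open iff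
both blocks `a` and `a + eᵢ` are good (Duminil-Copin–Sidoravicius–Tassion 2016 §2.2 shape; Grimmett
1999 p.178). -/
def coarseCfg (n : ℕ) (ω : BondConfig (Site 3)) : BondConfig (Site 2) :=
  {e | ∃ (a : Site 2) (i : Fin 2), e = s(a, a + Pi.single i 1) ∧
    ω ∈ goodBlock n a ∧ ω ∈ goodBlock n (a + Pi.single i 1)}

/-- The law of the coarse good-edge configuration under `P_p` (a dependent bond percolation on `ℤ²`). -/
def coarseLaw (n : ℕ) (p : unitInterval) : Measure (BondConfig (Site 2)) :=
  (bondPercolation (zdGraph 3) p).map (coarseCfg n)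

/-! ## Plumbing: locality, measurability, continuity -/

/-- `G_n` is a local event: it is determined by the pairs inside `B(n)` (witness `(box 3 n).sym2`:
configurations agreeing on those pairs induce the same open graph on the box, and every clause of
`G_n` is a reachability statement in that graph). Grimmett 1999, §7.4 p.177. -/
theorem isLocalEvent_goodBox (n : ℕ) : IsLocalEvent (goodBox n) := by
  refine ⟨(box 3 n).sym2, ?_⟩
  rw [determinedBy_iff]
  intro ω ω' hωω'
  have hG : (openGraph ω).induce (↑(box 3 n) : Set (Site 3)) =
      (openGraph ω').induce (↑(box 3 n) : Set (Site 3)) := by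
    ext a b
    simp only [SimpleGraph.comap_adj, Function.Embedding.coe_subtype, openGraph_adj]
    have he : s((a : Site 3), (b : Site 3)) ∈ (box 3 n).sym2 :=
      Finset.mk_mem_sym2_iff.2 ⟨Finset.mem_coe.1 a.2, Finset.mem_coe.1 b.2⟩
    have hab := Set.ext_iff.1 hωω' s((a : Site 3), (b : Site 3))
    simp only [Set.mem_inter_iff, Finset.mem_coe, he, and_true] at hab
    rw [hab]
  have hc : ∀ x y : Site 3,
      ω ∈ openConnIn ↑(box 3 n) x y ↔ ω' ∈ openConnIn ↑(box 3 n) x y := by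
    intro x y
    simp only [openConnIn, Set.mem_setOf_eq, hG]
  simp only [goodBox, Set.mem_setOf_eq, hc]

/-- `G_n` is measurable (a local event is a finite-dimensional cylinder). -/
theorem measurableSet_goodBox (n : ℕ) : MeasurableSet (goodBox n) :=
  measurableSet_of_isLocalEvent_holds (isLocalEvent_goodBox n)

/-- `q ↦ P_q(G_n)` is continuous on `[0,1]` (a polynomial in `q`: Grimmett 1999 §7.3 p.162), by the
proved `continuous_bondPercolation_real_of_isLocalEvent`. -/
theorem continuous_real_goodBox (n : ℕ) :
    Continuous fun q : unitInterval => (bondPercolation (zdGraph 3) q).real (goodBox n) :=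
  continuous_bondPercolation_real_of_isLocalEvent (zdGraph 3) (isLocalEvent_goodBox n)

/-- Good-block events are measurable (preimages of `G_n` under the measurable shift of configurations). -/
theorem measurableSet_goodBlock (n : ℕ) (a : Site 2) : MeasurableSet (goodBlock n a) :=
  (measurableSet_goodBox n).preimage
    (BondConfig.relabel (sym2Equiv (Site.shift (-blockCentre n a)))).measurable

/-- The coarse configuration is a measurable function of the configuration (port of
`measurable_coarseConfig`, SlabCriticalityInputs.lean). -/
theorem measurable_coarseCfg (n : ℕ) : Measurable (coarseCfg n) := by
  refine measurable_set_iff.2 fun e => ?_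
  refine measurableSet_setOf.1 ?_
  have : {ω : BondConfig (Site 3) | e ∈ coarseCfg n ω} =
      ⋃ a : Site 2, ⋃ i : Fin 2,
        {ω | e = s(a, a + Pi.single i 1) ∧ (ω ∈ goodBlock n a ∧ ω ∈ goodBlock n (a + Pi.single i 1))} := by
    ext ω
    simp only [coarseCfg, Set.mem_setOf_eq, Set.mem_iUnion]
  rw [this]
  refine MeasurableSet.iUnion fun a => MeasurableSet.iUnion fun i => ?_
  by_cases he : e = s(a, a + Pi.single i 1)
  · simp only [he, true_and]
    exact (measurableSet_goodBlock n a).inter (measurableSet_goodBlock n _)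
  · simp only [he, false_and, Set.setOf_false]
    exact MeasurableSet.empty

/-- The coarse law is a probability measure. -/
instance isProbabilityMeasure_coarseLaw (n : ℕ) (p : unitInterval) : IsProbabilityMeasure (coarseLaw n p) :=
  Measure.isProbabilityMeasure_map (measurable_coarseCfg n).aemeasurable

/-! ## The registered locality stub of the line -/

/-- **Registered stub `stub_goodBoxLocal` of crux stmt-CriticalPhenomena-0857 (line `registered`)**: the
good-box event `G_n`, spelled out, is a local event (= sibling item stmt-3841 `GoodBoxEventIsLocal` without
its idle guard `1 ≤ n`). Definitionally `isLocalEvent_goodBox`. -/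
theorem stub_goodBoxLocal :
    ∀ n : ℕ, IsLocalEvent {ω : BondConfig (Site 3) |
      (∃ x : Site 3, ∀ i : Fin 3,
          (∃ u : Site 3, u i = -(n : ℤ) ∧ ω ∈ openConnIn ↑(box 3 n) x u) ∧
            (∃ v : Site 3, v i = (n : ℤ) ∧ ω ∈ openConnIn ↑(box 3 n) x v)) ∧
        (∀ x y : Site 3,
          (∃ u v : Site 3, ω ∈ openConnIn ↑(box 3 n) x u ∧ ω ∈ openConnIn ↑(box 3 n) x v ∧
              ∃ i, (n : ℤ) ≤ |u i - v i|) →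
            (∃ u v : Site 3, ω ∈ openConnIn ↑(box 3 n) y u ∧ ω ∈ openConnIn ↑(box 3 n) y v ∧
                ∃ i, (n : ℤ) ≤ |u i - v i|) →
              ω ∈ openConnIn ↑(box 3 n) x y)} :=
  isLocalEvent_goodBox

end Summit.CriticalPhenomena.PercolationContinuityZ3.Theorems.RenormaliseFromLinearLRO

end
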